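import Summits.QuantumFields.BalabanUV.Beta.GAN24.EEWordValue
import Summits.QuantumFields.BalabanUV.Beta.GAN24.DressedWilsonHalfVertexAnyAxis
import Summits.QuantumFields.BalabanUV.Beta.GAN24.ExchangeSlotResum

/-!
# (C)sym at level 0 — THE SWAP WORD OF THE TWO-FACE READ-OUT AND THE EE WORD FOR EVERY AXIS PATTERN: `ee_word_value'`, `ee_word_swap_value`, `ee_word_pair_value`
# (blueprint `HOME/b2b-balaban-gan24-formalise-leaf-04/g65/CSYM-LEVEL0-KERNEL-BLUEPRINT.md` §6 (L2))

WHAT. The two-face read-out of an2's `K3OfK` through the dressed step kernel (`DressedStepFaceCharges.hasSum_mmRead_K3OfK_dressedStep`) carries, besides the `K·W·K` word, the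
TWO exchange words `FF[(dM_b∘X̃♮)∘dM_{b′}]` (DIRECT: `EEWordValue.ee_word_value`) and `FF[(dM_{b′}∘X̃♮)∘dM_b]` (SWAP), `b = (μ, u)` over one coarse cell, `b′ = (ν, u′)` over the
lattice, legs read at the `α`- resp. `β`-exit faces.  Here (`X̃♮_0 = unitK s_f s_m (coDressKBmAt ρ Lc (KInvStep Lc 0))`, `S^E = unitS s_f s_m (cE • wilsonA)`, `V_{κ,v} =
vertexOfK X̃♮_0 Lc S^E κ v`, in-block root, `1 ≤ Lc`, all units):
* §1 **`twoFace_word_cov`** (every level `j`: the two-face word `FF[(V_{ν,a}∘X̃♮_j)∘V_{μ,b}]` is JOINTLY coarse-bond covariant in `(a, b)` — an2's `vertexOfK_translate`,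
  `EEWordReduced.shiftK_dressedStep ∕ unitS_wilsonA_translate`, `ExchangeSlotResum.twoFace_word_cov_of`), **`tsum_swap_word`** (`Σ'_{u′} FF[(V_{ν,u′}∘X̃♮_j)∘V_{μ,c}] =
  Σ'_{u′} FF[(V_{ν,c}∘X̃♮_j)∘V_{μ,u′}]`: in the swap word the lattice sum may be moved to the OTHER bond, `ExchangeSlotResum.tsum_eq_tsum_of_cov`);
* §2 **`ee_word_outer_fubini'`** — `EEWordValue.ee_word_outer_fubini` for EVERY `(ν, β)` (at `ν = β` the resummed right slot is `0` by
  `DressedWilsonHalfVertexAnyAxis.tsum_faceHalfVertex_snd_diag`, and `fubini3` runs with the bound `M = 0`);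
* §3 **`ee_word_value'`** — `ee_word_value` for EVERY `(μ, ν, α, β)`: `Σ_{u ∈ box Lc} Σ'_{u′} FF[(V_{μ,u}∘X̃♮_0)∘V_{ν,u′}] = −K₁²·s_f²·E·½·Lc^{d−1}·(Lc^{d+1} − Lc^{d−1})`,
  `E = [μ=ν][α=β] − [μ=β][α=ν]` (the degenerate axes `μ = α` ∕ `ν = β` give `0 = 0`: same-axis half-vertices vanish, and `E = 0` there);
* §4 **`ee_word_swap_value`** — THE SWAP WORD: `Σ_{u ∈ box Lc} Σ'_{u′} FF[(V_{ν,u′}∘X̃♮_0)∘V_{μ,u}] = −K₁²·s_f²·E′·½·Lc^{d−1}·(Lc^{d+1} − Lc^{d−1})` with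
  `E′ = [μ=ν][α=β] − [ν=β][α=μ]` (§1 ⨾ §3 with `μ ↔ ν`) — NOT «the same number with `E` symmetric» as blueprint §6 (L2) guessed: in the cross pattern `(μ,ν;α,β) = (μ,α;α,μ)`
  the direct word has `E = −1` and the swap word `E′ = 0` (both its half-vertices are same-axis), in `(μ,μ;α,α)` both are `1` — cf. g64's `WilsonEdgeCurrentDiag` header;
  **`ee_word_pair_value`** — DIRECT + SWAP `= −K₁²·s_f²·(E + E′)·½·Lc^{d−1}·(Lc^{d+1} − Lc^{d−1})`, `E + E′ = 2[μ=ν][α=β] − [μ=β][α=ν] − [ν=β][α=μ]`.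

HONEST: [folklore] `tsum` reindexing ∕ bookkeeping BY NAME over this lineage's GAN24 files 9 ∕ 13 ∕ 14 ∕ 15 ∕ 16 ∕ 17 ∕ 18 ∕ 19 ∕ 22 and an2's kernel calculus; no value of Bałaban's tables
beyond an3's DEFINED stencil is asserted; the numbers are the two exchange words of piece (II) of the level-0 (C_1) balance ONLY — the `K·W·K` word (L3), (I)'s junction with p2's
`zmode_succ_eq_fourFace` (L4) and (III) (L5) remain; (C)sym stays DISPLAYED — nothing of (C)∕(Q-D)∕(Q-D-rate) is discharged; NEVER «G-an2-4 closed» as (CONV-C); NOT D1, NOT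
BetaPertH, NOT continuum, NOT Clay.  HONEST DEPENDENCY (verbatim): «continuum YM on T⁴ ⇐ BetaPertH ∧ nine spine estimates (0/9 proved); BetaPertH ⇐ (D1) ∧ (D4) ∧ CAP+tail;
G-an2-4 gates asym, D1 and NE2/3/4.»  G-an2-4 formalisation swarm, leaf prover `b2b-balaban-gan24-formalise-leaf-04`, gen 66, 2026-08-23; no existing file touched.
-/

noncomputable section

open Finset
open scoped BigOperators
open Literature.MathematicalPhysics.QuantumFieldTheory
open Literature.MathematicalPhysics.QuantumFieldTheory.Balaban1983to89
open Literature.MathematicalPhysics.QuantumFieldTheory.Balaban1983to89.Beta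
open B12Sec2to5 (l1 l1_nonneg)
open ExpKernelCalculus (Site MKer comp shiftK comp_shiftK Decays VertexFamily)
open Summit.QuantumFields.BalabanUV.Beta.GAN24.ExchangeSlotResum (tsum_eq_tsum_of_cov twoFace_word_cov_of face_weight_periodic)
open OneStepResolventKernel (Fib LocStencil decays_mono)
open OneStepKernelFamily (KInvStep vertexOfK vertexOfK_translate vertexFamily_vertexOfK decays_KInvStep)
open StepJetData (wilsonA locStencil_wilsonA locStencil_smul)
open AffineAveraging (Form1 Form2 box toSite curvAdj)
open KKTFluctuationKernel (Gam)
open PeriodicDescent (IsPeriodic)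
open Summit.QuantumFields.BalabanUV.Beta.AxialDressingRooted (coDressKBmAt coProjBmW decays_coDressKBmAt)
open Summit.QuantumFields.BalabanUV.Beta.HessKerDressedUnits (unitK unitS decays_unitK locStencil_unitS)
open Summit.QuantumFields.BalabanUV.Beta.GAN24.PeriodicForceMultiplier (bounded_of_periodic)
open Summit.QuantumFields.BalabanUV.Beta.GAN24.DressedKernelOnFaceCurrent (smul_curvAdj_periodic facePlaq_periodic tsum_dressedStep_zero_inl_mul_halfVertex_snd)
open Summit.QuantumFields.BalabanUV.Beta.GAN24.CoarseBondCellPairing (sum_box_tsum_sum_mul_periodic_of_cov)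
open Summit.QuantumFields.BalabanUV.Beta.GAN24.EEWordReduced (coProjBmW_add_zsmul shiftK_dressedStep unitS_wilsonA_translate leftFamily_cov summable_leftFamily_mul)
open Summit.QuantumFields.BalabanUV.Beta.GAN24.ExchangeFieldLegs (tsum_prod_faceHalfVertex)
open Summit.QuantumFields.BalabanUV.Beta.GAN24.ExchangeSlotLiteral (hasSum_literal_slot)
open Summit.QuantumFields.BalabanUV.Beta.GAN24.EEWordValue (fubini3 ee_word_outer_fubini ee_word_value)
open Summit.QuantumFields.BalabanUV.Beta.GAN24.DressedWilsonHalfVertexAnyAxis (tsum_faceHalfVertex_fst_diag tsum_faceHalfVertex_snd_diag)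

namespace Summit.QuantumFields.BalabanUV.Beta.GAN24.EEWordSwap

variable {d : ℕ}

/-! ## §1 The two-face word is jointly coarse-bond covariant; the swap identity -/

section Cov

variable {Lc : ℕ} [NeZero Lc] {r : Fin (d + 1) → ℕ} {μ ν α β : Fin (d + 1)}

/-- [folklore] **THE TWO-FACE WORD IS JOINTLY COARSE-BOND COVARIANT** (every level `j`, all units, any `(μ, ν, α, β)`): with `V_{κ,v} = vertexOfK X̃♮_j Lc S^E κ v`,
`FF[(V_{ν,a+t} ∘ X̃♮_j) ∘ V_{μ,b+t}] = FF[(V_{ν,a} ∘ X̃♮_j) ∘ V_{μ,b}]` for every `t ∈ ℤ^{d+1}` — `vertexOfK_translate` (block covariance of `X̃♮_j`: `EEWordReduced.shiftK_dressedStep`;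
fine covariance of `S^E`: `unitS_wilsonA_translate`), `comp_shiftK` twice, `tsum_twoFace_shiftK`. -/
theorem twoFace_word_cov (hLc : 1 ≤ Lc) (sf sm cE : ℝ) (j : ℕ) (a b t : Site (d + 1)) :
    ∑' yw : Site (d + 1) × Site (d + 1), (if yw.1 α % (Lc : ℤ) = (Lc : ℤ) - 1 then (1 : ℝ) else 0) * (if yw.2 β % (Lc : ℤ) = (Lc : ℤ) - 1 then (1 : ℝ) else 0) *
        comp (comp (vertexOfK (unitK sf sm (coDressKBmAt (toSite r) Lc (KInvStep (d := d) Lc j))) Lc (unitS sf sm (fun κ v => cE • wilsonA d κ v)) ν (a + t))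
          (unitK sf sm (coDressKBmAt (toSite r) Lc (KInvStep (d := d) Lc j))))
          (vertexOfK (unitK sf sm (coDressKBmAt (toSite r) Lc (KInvStep (d := d) Lc j))) Lc (unitS sf sm (fun κ v => cE • wilsonA d κ v)) μ (b + t)) yw.1 yw.2 (Sum.inl α) (Sum.inl β) =
      ∑' yw : Site (d + 1) × Site (d + 1), (if yw.1 α % (Lc : ℤ) = (Lc : ℤ) - 1 then (1 : ℝ) else 0) * (if yw.2 β % (Lc : ℤ) = (Lc : ℤ) - 1 then (1 : ℝ) else 0) *
        comp (comp (vertexOfK (unitK sf sm (coDressKBmAt (toSite r) Lc (KInvStep (d := d) Lc j))) Lc (unitS sf sm (fun κ v => cE • wilsonA d κ v)) ν a)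
          (unitK sf sm (coDressKBmAt (toSite r) Lc (KInvStep (d := d) Lc j))))
          (vertexOfK (unitK sf sm (coDressKBmAt (toSite r) Lc (KInvStep (d := d) Lc j))) Lc (unitS sf sm (fun κ v => cE • wilsonA d κ v)) μ b) yw.1 yw.2 (Sum.inl α) (Sum.inl β) := by
  have hXs : ∀ t' : Site (d + 1), shiftK (-((Lc : ℤ) • t')) (unitK sf sm (coDressKBmAt (toSite r) Lc (KInvStep (d := d) Lc j))) =
      unitK sf sm (coDressKBmAt (toSite r) Lc (KInvStep (d := d) Lc j)) := fun t' => shiftK_dressedStep (r := r) hLc sf sm j t'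
  exact twoFace_word_cov_of (N := Lc) (fun a' t' => vertexOfK_translate (N := Lc) hXs (unitS_wilsonA_translate (d := d) sf sm cE) ν a' t')
    (fun b' t' => vertexOfK_translate (N := Lc) hXs (unitS_wilsonA_translate (d := d) sf sm cE) μ b' t') hXs
    (ρ₁ := fun y : Site (d + 1) => (if y α % (Lc : ℤ) = (Lc : ℤ) - 1 then (1 : ℝ) else 0))
    (ρ₂ := fun w : Site (d + 1) => (if w β % (Lc : ℤ) = (Lc : ℤ) - 1 then (1 : ℝ) else 0))
    (fun y s => face_weight_periodic Lc α y s) (fun w s => face_weight_periodic Lc β w s) a b t (Sum.inl α) (Sum.inl β)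

/-- [folklore] **THE SWAP IDENTITY** (every level `j`, all units, any axes, any `c`): `Σ'_{u′} FF[(V_{ν,u′} ∘ X̃♮_j) ∘ V_{μ,c}] = Σ'_{u′} FF[(V_{ν,c} ∘ X̃♮_j) ∘ V_{μ,u′}]` — in the swap
word the lattice-summed bond may be taken to be the RIGHT one (§1 on the jointly covariant two-face word). -/
theorem tsum_swap_word (hLc : 1 ≤ Lc) (sf sm cE : ℝ) (j : ℕ) (c : Site (d + 1)) :
    ∑' u' : Site (d + 1), ∑' yw : Site (d + 1) × Site (d + 1), (if yw.1 α % (Lc : ℤ) = (Lc : ℤ) - 1 then (1 : ℝ) else 0) * (if yw.2 β % (Lc : ℤ) = (Lc : ℤ) - 1 then (1 : ℝ) else 0) *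
        comp (comp (vertexOfK (unitK sf sm (coDressKBmAt (toSite r) Lc (KInvStep (d := d) Lc j))) Lc (unitS sf sm (fun κ v => cE • wilsonA d κ v)) ν u')
          (unitK sf sm (coDressKBmAt (toSite r) Lc (KInvStep (d := d) Lc j))))
          (vertexOfK (unitK sf sm (coDressKBmAt (toSite r) Lc (KInvStep (d := d) Lc j))) Lc (unitS sf sm (fun κ v => cE • wilsonA d κ v)) μ c) yw.1 yw.2 (Sum.inl α) (Sum.inl β) =
      ∑' u' : Site (d + 1), ∑' yw : Site (d + 1) × Site (d + 1), (if yw.1 α % (Lc : ℤ) = (Lc : ℤ) - 1 then (1 : ℝ) else 0) * (if yw.2 β % (Lc : ℤ) = (Lc : ℤ) - 1 then (1 : ℝ) else 0) *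
        comp (comp (vertexOfK (unitK sf sm (coDressKBmAt (toSite r) Lc (KInvStep (d := d) Lc j))) Lc (unitS sf sm (fun κ v => cE • wilsonA d κ v)) ν c)
          (unitK sf sm (coDressKBmAt (toSite r) Lc (KInvStep (d := d) Lc j))))
          (vertexOfK (unitK sf sm (coDressKBmAt (toSite r) Lc (KInvStep (d := d) Lc j))) Lc (unitS sf sm (fun κ v => cE • wilsonA d κ v)) μ u') yw.1 yw.2 (Sum.inl α) (Sum.inl β) :=
  tsum_eq_tsum_of_cov (G := fun a b => ∑' yw : Site (d + 1) × Site (d + 1), (if yw.1 α % (Lc : ℤ) = (Lc : ℤ) - 1 then (1 : ℝ) else 0) * (if yw.2 β % (Lc : ℤ) = (Lc : ℤ) - 1 then (1 : ℝ) else 0) *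
        comp (comp (vertexOfK (unitK sf sm (coDressKBmAt (toSite r) Lc (KInvStep (d := d) Lc j))) Lc (unitS sf sm (fun κ v => cE • wilsonA d κ v)) ν a)
          (unitK sf sm (coDressKBmAt (toSite r) Lc (KInvStep (d := d) Lc j))))
          (vertexOfK (unitK sf sm (coDressKBmAt (toSite r) Lc (KInvStep (d := d) Lc j))) Lc (unitS sf sm (fun κ v => cE • wilsonA d κ v)) μ b) yw.1 yw.2 (Sum.inl α) (Sum.inl β))
    (fun a b t => twoFace_word_cov (μ := μ) (ν := ν) (α := α) (β := β) hLc sf sm cE j a b t) c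

end Cov

/-! ## §2 The outer Fubini for every `(ν, β)` -/

section Fubini

variable {Lc : ℕ} [NeZero Lc] {r : Fin (d + 1) → ℕ} {μ ν α β : Fin (d + 1)}

/-- [folklore] **THE OUTER FUBINI FOR EVERY `(ν, β)`** (in-block root, `1 ≤ Lc`, all units, fixed first bond `(μ, u)`): the statement of `EEWordValue.ee_word_outer_fubini` without
`ν ≠ β` — at `ν = β` the resummed right slot `Σ'_{u′} Σ'_w 𝟙f(w_β)·V_{β,u′} z w (inl b)(inl β)` is `0` (`tsum_faceHalfVertex_snd_diag`), so `fubini3` runs with `M = 0`. -/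
theorem ee_word_outer_fubini' (hLc : 1 ≤ Lc) (hr : r ∈ box (d + 1) Lc) (sf sm cE : ℝ) (u : Site (d + 1)) :
    ∑' u' : Site (d + 1), ∑' yw : Site (d + 1) × Site (d + 1), (if yw.1 α % (Lc : ℤ) = (Lc : ℤ) - 1 then (1 : ℝ) else 0) * (if yw.2 β % (Lc : ℤ) = (Lc : ℤ) - 1 then (1 : ℝ) else 0) *
        comp (comp (vertexOfK (unitK sf sm (coDressKBmAt (toSite r) Lc (KInvStep (d := d) Lc 0))) Lc (unitS sf sm (fun κ v => cE • wilsonA d κ v)) μ u) (unitK sf sm (coDressKBmAt (toSite r) Lc (KInvStep (d := d) Lc 0)))) (vertexOfK (unitK sf sm (coDressKBmAt (toSite r) Lc (KInvStep (d := d) Lc 0))) Lc (unitS sf sm (fun κ v => cE • wilsonA d κ v)) ν u') yw.1 yw.2 (Sum.inl α) (Sum.inl β) =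
      ∑' y₁ : Site (d + 1), ∑ a : Fin (d + 1),
        (∑' y : Site (d + 1), (if y α % (Lc : ℤ) = (Lc : ℤ) - 1 then (1 : ℝ) else 0) * vertexOfK (unitK sf sm (coDressKBmAt (toSite r) Lc (KInvStep (d := d) Lc 0))) Lc (unitS sf sm (fun κ v => cE • wilsonA d κ v)) μ u y y₁ (Sum.inl α) (Sum.inl a)) *
        (∑' z : Site (d + 1), ∑ b : Fin (d + 1), unitK sf sm (coDressKBmAt (toSite r) Lc (KInvStep (d := d) Lc 0)) y₁ z (Sum.inl a) (Sum.inl b) *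
          (∑' u' : Site (d + 1), ∑' w : Site (d + 1), (if w β % (Lc : ℤ) = (Lc : ℤ) - 1 then (1 : ℝ) else 0) * vertexOfK (unitK sf sm (coDressKBmAt (toSite r) Lc (KInvStep (d := d) Lc 0))) Lc (unitS sf sm (fun κ v => cE • wilsonA d κ v)) ν u' z w (Sum.inl b) (Sum.inl β))) := by
  classical
  by_cases hνβ : ν ≠ β
  · exact ee_word_outer_fubini hνβ hLc hr sf sm cE u
  rw [not_not] at hνβ
  subst hνβ
  rw [(hasSum_literal_slot (μ := μ) (ν := ν) (α := α) (β := ν) hLc hr sf sm cE 0 u).tsum_eq]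
  simp only [tsum_prod_faceHalfVertex hLc hr sf sm cE 0 ν ν]
  -- decay data at one rate
  obtain ⟨δK, CK, hδK, hCK, hXd⟩ := decays_coDressKBmAt hLc hr (decays_KInvStep (d := d) (Lc := Lc) 0)
  have hXu := decays_unitK (sf := sf) (sm := sm) hXd
  have hS := locStencil_unitS (sf := sf) (sm := sm) (locStencil_smul cE (locStencil_wilsonA (d := d) hδK.le))
  have hC : 0 ≤ max |sf| |sm| * CK * max |sf| |sm| := by positivity
  obtain ⟨Cv, hVF⟩ : ∃ Cv : ℝ, VertexFamily (vertexOfK (unitK sf sm (coDressKBmAt (toSite r) Lc (KInvStep (d := d) Lc 0))) Lc (unitS sf sm (fun κ v => cE • wilsonA d κ v))) Lc Cv (δK / 2) :=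
    ⟨_, vertexFamily_vertexOfK (N := Lc) hXu hC hS hδK le_rfl⟩
  have hCv : 0 ≤ Cv := (hVF μ 0).nonneg (Sum.inl 0)
  have hXu' : Decays (unitK sf sm (coDressKBmAt (toSite r) Lc (KInvStep (d := d) Lc 0))) (max |sf| |sm| * CK * max |sf| |sm|) (δK / 2) := decays_mono hXu hC le_rfl (by linarith)
  -- the resummed right slot vanishes (same axis)
  have hT : ∀ (b : Fin (d + 1)) (z : Site (d + 1)),
      |∑' u' : Site (d + 1), ∑' w : Site (d + 1), (if w ν % (Lc : ℤ) = (Lc : ℤ) - 1 then (1 : ℝ) else 0) * vertexOfK (unitK sf sm (coDressKBmAt (toSite r) Lc (KInvStep (d := d) Lc 0))) Lc (unitS sf sm (fun κ v => cE • wilsonA d κ v)) ν u' z w (Sum.inl b) (Sum.inl ν)| ≤ 0 := by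
    intro b z
    rw [tsum_faceHalfVertex_snd_diag hLc hr sf sm cE 0 b z, abs_zero]
  exact fubini3 (f := fun y => (if y α % (Lc : ℤ) = (Lc : ℤ) - 1 then (1 : ℝ) else 0)) (V := fun y y₁ a => vertexOfK (unitK sf sm (coDressKBmAt (toSite r) Lc (KInvStep (d := d) Lc 0))) Lc (unitS sf sm (fun κ v => cE • wilsonA d κ v)) μ u y y₁ (Sum.inl α) (Sum.inl a))
    (X := fun y₁ z a b => unitK sf sm (coDressKBmAt (toSite r) Lc (KInvStep (d := d) Lc 0)) y₁ z (Sum.inl a) (Sum.inl b))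
    (T := fun b z => ∑' u' : Site (d + 1), ∑' w : Site (d + 1), (if w ν % (Lc : ℤ) = (Lc : ℤ) - 1 then (1 : ℝ) else 0) * vertexOfK (unitK sf sm (coDressKBmAt (toSite r) Lc (KInvStep (d := d) Lc 0))) Lc (unitS sf sm (fun κ v => cE • wilsonA d κ v)) ν u' z w (Sum.inl b) (Sum.inl ν))
    (c := (Lc : ℤ) • u) (half_pos hδK) hCv hC le_rfl
    (fun y => by split_ifs <;> simp) (fun y y₁ a => hVF μ u y y₁ (Sum.inl α) (Sum.inl a)) (fun y₁ z a b => hXu' y₁ z (Sum.inl a) (Sum.inl b)) hT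

end Fubini

/-! ## §3 The EE word for every axis pattern -/

section Value

variable {Lc : ℕ} [NeZero Lc] {r : Fin (d + 1) → ℕ} {μ ν α β : Fin (d + 1)}

/-- [folklore] **THE EE EXCHANGE WORD OF THE DRESSED LEVEL-0 SOURCE FOR EVERY AXIS PATTERN `(μ, ν, α, β)`** (in-block root `ρ = toSite r`, `1 ≤ Lc`, all units): the statement
of `EEWordValue.ee_word_value` without `μ ≠ α`, `ν ≠ β` —
`Σ_{u ∈ box Lc} Σ'_{u′} Σ'_{(y,w)} 𝟙f(y_α)𝟙f(w_β)·((V_{μ,u} ∘ X̃♮_0) ∘ V_{ν,u′}) y w (inl α)(inl β) = −K₁²·s_f²·E·½·Lc^{d−1}·(Lc^{d+1} − Lc^{d−1})`, `E = [μ=ν][α=β] − [μ=β][α=ν]`.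
At `ν = β` the resummed right slot is `0` (§2 then `tsum_faceHalfVertex_snd_diag`); at `μ = α` (`ν ≠ β`) the reduced word is `|box|·Σ_cell (Σ'_u j_u)·A′`
(`CoarseBondCellPairing.sum_box_tsum_sum_mul_periodic_of_cov` as in `EEWordReduced.ee_word_reduced`) with `Σ'_u j_u = 0` (`tsum_faceHalfVertex_fst_diag`); `E = 0` in both. -/
theorem ee_word_value' (hLc : 1 ≤ Lc) (hr : r ∈ box (d + 1) Lc) (sf sm cE : ℝ) :
    ∑ u ∈ box (d + 1) Lc, ∑' u' : Site (d + 1), ∑' yw : Site (d + 1) × Site (d + 1), (if yw.1 α % (Lc : ℤ) = (Lc : ℤ) - 1 then (1 : ℝ) else 0) * (if yw.2 β % (Lc : ℤ) = (Lc : ℤ) - 1 then (1 : ℝ) else 0) *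
        comp (comp (vertexOfK (unitK sf sm (coDressKBmAt (toSite r) Lc (KInvStep (d := d) Lc 0))) Lc (unitS sf sm (fun κ v => cE • wilsonA d κ v)) μ (toSite u)) (unitK sf sm (coDressKBmAt (toSite r) Lc (KInvStep (d := d) Lc 0)))) (vertexOfK (unitK sf sm (coDressKBmAt (toSite r) Lc (KInvStep (d := d) Lc 0))) Lc (unitS sf sm (fun κ v => cE • wilsonA d κ v)) ν u') yw.1 yw.2 (Sum.inl α) (Sum.inl β) =
      -(((((Lc : ℝ) * (sm * sf)) * ((((Lc ^ (0 + 1) : ℕ) : ℝ)) ^ (d + 1 + 1))⁻¹) * ((sf * sm)⁻¹ * (sf⁻¹ * sf⁻¹) * cE))) ^ 2 * (sf * sf) *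
        (((if μ = ν ∧ α = β then (1 : ℝ) else 0) - (if μ = β ∧ α = ν then (1 : ℝ) else 0)) * ((1 / 2 : ℝ) * (Lc : ℝ) ^ (d - 1) * ((Lc : ℝ) ^ (d + 1) - (Lc : ℝ) ^ (d - 1)))) := by
  classical
  by_cases hνβ : ν = β
  · -- the resummed right slot vanishes
    subst hνβ
    rw [Finset.sum_congr rfl fun u _ => ee_word_outer_fubini' (μ := μ) (ν := ν) (α := α) (β := ν) hLc hr sf sm cE (toSite u)]
    simp only [tsum_faceHalfVertex_snd_diag hLc hr sf sm cE 0, mul_zero, Finset.sum_const_zero, tsum_zero]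
    have hE : ((if μ = ν ∧ α = ν then (1 : ℝ) else 0) - (if μ = ν ∧ α = ν then (1 : ℝ) else 0)) = 0 := sub_self _
    rw [hE]
    ring
  by_cases hμα : μ = α
  · -- the resummed left family vanishes
    subst hμα
    rw [Finset.sum_congr rfl fun u _ => ee_word_outer_fubini' (μ := μ) (ν := ν) (α := μ) (β := β) hLc hr sf sm cE (toSite u)]
    simp only [tsum_dressedStep_zero_inl_mul_halfVertex_snd hνβ hLc hr sf sm cE]
    set Fνβ : Form2 (d + 1) ℝ := fun κ l (x : Site (d + 1)) =>
      (if κ = ν ∧ l = β then (if x ν % (Lc : ℤ) = (Lc : ℤ) - 1 then (1 : ℝ) else 0) * (if x β % (Lc : ℤ) = (Lc : ℤ) - 1 then (1 : ℝ) else 0) else 0) -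
      (if κ = β ∧ l = ν then (if x ν % (Lc : ℤ) = (Lc : ℤ) - 1 then (1 : ℝ) else 0) * (if x β % (Lc : ℤ) = (Lc : ℤ) - 1 then (1 : ℝ) else 0) else 0) with hFνβ
    set K₁ : ℝ := (((Lc : ℝ) * (sm * sf)) * ((((Lc ^ (0 + 1) : ℕ) : ℝ)) ^ (d + 1 + 1))⁻¹) * ((sf * sm)⁻¹ * (sf⁻¹ * sf⁻¹) * cE) with hK₁
    set A : Form1 (d + 1) ℝ := fun κ u => ∑' u'' : Site (d + 1), ∑ κ' : Fin (d + 1), (K₁ * ((1 / 2 : ℝ) * curvAdj Fνβ κ' u'')) * Gam (N := Lc) κ u κ' u'' with hA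
    have hGp : ∀ κ l, IsPeriodic Lc (Fνβ κ l) := facePlaq_periodic (d := d) Lc ν β
    have hAp : ∀ κ (y z : Site (d + 1)), A κ (y + (Lc : ℤ) • z) = A κ y := by
      intro κ y z
      simp only [hA]
      exact PeriodicKKTResponse.respA_periodic (N := Lc) (fun l y s => by
        have h := smul_curvAdj_periodic (N := Lc) hGp (1 / 2 : ℝ) l y s
        rw [h]) κ y z
    have hA'p : ∀ (a : Fin (d + 1)) (y z : Site (d + 1)), (sf * sf) * coProjBmW (toSite r) Lc A a (y + (Lc : ℤ) • z) = (sf * sf) * coProjBmW (toSite r) Lc A a y :=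
      fun a y z => by rw [coProjBmW_add_zsmul (toSite r) hLc hAp]
    have h13 := sum_box_tsum_sum_mul_periodic_of_cov (N := Lc)
      (j := fun (u : Site (d + 1)) (a : Fin (d + 1)) (y₁ : Site (d + 1)) => ∑' y : Site (d + 1), (if y μ % (Lc : ℤ) = (Lc : ℤ) - 1 then (1 : ℝ) else 0) *
        vertexOfK (unitK sf sm (coDressKBmAt (toSite r) Lc (KInvStep (d := d) Lc 0))) Lc (unitS sf sm (fun κ v => cE • wilsonA d κ v)) μ u y y₁ (Sum.inl μ) (Sum.inl a))
      (A := fun a y₁ => (sf * sf) * coProjBmW (toSite r) Lc A a y₁)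
      (fun u a y₁ t => leftFamily_cov (r := r) (μ := μ) (α := μ) hLc sf sm cE 0 u a y₁ t) hA'p
      (fun u a => summable_leftFamily_mul (μ := μ) (α := μ) hLc hr sf sm cE 0
        (bounded_of_periodic (Lc := Lc) (V := fun y => (sf * sf) * coProjBmW (toSite r) Lc A a y) (fun y z => hA'p a y z)) u a)
    beta_reduce at h13
    rw [h13]
    simp only [tsum_faceHalfVertex_fst_diag hLc hr sf sm cE 0, zero_mul, Finset.sum_const_zero, mul_zero]
    have hE : ((if μ = ν ∧ μ = β then (1 : ℝ) else 0) - (if μ = β ∧ μ = ν then (1 : ℝ) else 0)) = 0 := by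
      by_cases h1 : μ = ν <;> by_cases h2 : μ = β <;> simp [h1, h2]
    rw [hE]
    ring
  exact ee_word_value hμα hνβ hLc hr sf sm cE

/-! ## §4 The swap word and the pair -/

/-- [folklore] **THE SWAP WORD OF THE TWO-FACE READ-OUT AS ONE NUMBER** (every axis pattern; in-block root, `1 ≤ Lc`, all units): with the lattice sum on the LEFT bond,
`Σ_{u ∈ box Lc} Σ'_{u′} Σ'_{(y,w)} 𝟙f(y_α)𝟙f(w_β)·((V_{ν,u′} ∘ X̃♮_0) ∘ V_{μ,u}) y w (inl α)(inl β) = −K₁²·s_f²·E′·½·Lc^{d−1}·(Lc^{d+1} − Lc^{d−1})`,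
`E′ = [ν=μ][α=β] − [ν=β][α=μ]` (`tsum_swap_word` ⨾ `ee_word_value'` with `μ ↔ ν`).  In the cross pattern `(μ,ν;α,β) = (μ,α;α,μ)`, `μ ≠ α`, `E′ = 0` while the direct word has
`E = −1`; in `(μ,μ;α,α)` both are `1`. -/
theorem ee_word_swap_value (hLc : 1 ≤ Lc) (hr : r ∈ box (d + 1) Lc) (sf sm cE : ℝ) :
    ∑ u ∈ box (d + 1) Lc, ∑' u' : Site (d + 1), ∑' yw : Site (d + 1) × Site (d + 1), (if yw.1 α % (Lc : ℤ) = (Lc : ℤ) - 1 then (1 : ℝ) else 0) * (if yw.2 β % (Lc : ℤ) = (Lc : ℤ) - 1 then (1 : ℝ) else 0) *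
        comp (comp (vertexOfK (unitK sf sm (coDressKBmAt (toSite r) Lc (KInvStep (d := d) Lc 0))) Lc (unitS sf sm (fun κ v => cE • wilsonA d κ v)) ν u') (unitK sf sm (coDressKBmAt (toSite r) Lc (KInvStep (d := d) Lc 0)))) (vertexOfK (unitK sf sm (coDressKBmAt (toSite r) Lc (KInvStep (d := d) Lc 0))) Lc (unitS sf sm (fun κ v => cE • wilsonA d κ v)) μ (toSite u)) yw.1 yw.2 (Sum.inl α) (Sum.inl β) =
      -(((((Lc : ℝ) * (sm * sf)) * ((((Lc ^ (0 + 1) : ℕ) : ℝ)) ^ (d + 1 + 1))⁻¹) * ((sf * sm)⁻¹ * (sf⁻¹ * sf⁻¹) * cE))) ^ 2 * (sf * sf) *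
        (((if ν = μ ∧ α = β then (1 : ℝ) else 0) - (if ν = β ∧ α = μ then (1 : ℝ) else 0)) * ((1 / 2 : ℝ) * (Lc : ℝ) ^ (d - 1) * ((Lc : ℝ) ^ (d + 1) - (Lc : ℝ) ^ (d - 1)))) := by
  rw [Finset.sum_congr rfl fun u _ => tsum_swap_word (r := r) (μ := μ) (ν := ν) (α := α) (β := β) hLc sf sm cE 0 (toSite u)]
  exact ee_word_value' (μ := ν) (ν := μ) (α := α) (β := β) hLc hr sf sm cE

/-- [folklore] **DIRECT + SWAP** (every axis pattern): the sum of the two exchange words of the two-face read-out is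
`−K₁²·s_f²·(E + E′)·½·Lc^{d−1}·(Lc^{d+1} − Lc^{d−1})`, `E + E′ = 2[μ=ν][α=β] − [μ=β][α=ν] − [ν=β][α=μ]`. -/
theorem ee_word_pair_value (hLc : 1 ≤ Lc) (hr : r ∈ box (d + 1) Lc) (sf sm cE : ℝ) :
    (∑ u ∈ box (d + 1) Lc, ∑' u' : Site (d + 1), ∑' yw : Site (d + 1) × Site (d + 1), (if yw.1 α % (Lc : ℤ) = (Lc : ℤ) - 1 then (1 : ℝ) else 0) * (if yw.2 β % (Lc : ℤ) = (Lc : ℤ) - 1 then (1 : ℝ) else 0) *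
        comp (comp (vertexOfK (unitK sf sm (coDressKBmAt (toSite r) Lc (KInvStep (d := d) Lc 0))) Lc (unitS sf sm (fun κ v => cE • wilsonA d κ v)) μ (toSite u)) (unitK sf sm (coDressKBmAt (toSite r) Lc (KInvStep (d := d) Lc 0)))) (vertexOfK (unitK sf sm (coDressKBmAt (toSite r) Lc (KInvStep (d := d) Lc 0))) Lc (unitS sf sm (fun κ v => cE • wilsonA d κ v)) ν u') yw.1 yw.2 (Sum.inl α) (Sum.inl β)) +
    (∑ u ∈ box (d + 1) Lc, ∑' u' : Site (d + 1), ∑' yw : Site (d + 1) × Site (d + 1), (if yw.1 α % (Lc : ℤ) = (Lc : ℤ) - 1 then (1 : ℝ) else 0) * (if yw.2 β % (Lc : ℤ) = (Lc : ℤ) - 1 then (1 : ℝ) else 0) *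
        comp (comp (vertexOfK (unitK sf sm (coDressKBmAt (toSite r) Lc (KInvStep (d := d) Lc 0))) Lc (unitS sf sm (fun κ v => cE • wilsonA d κ v)) ν u') (unitK sf sm (coDressKBmAt (toSite r) Lc (KInvStep (d := d) Lc 0)))) (vertexOfK (unitK sf sm (coDressKBmAt (toSite r) Lc (KInvStep (d := d) Lc 0))) Lc (unitS sf sm (fun κ v => cE • wilsonA d κ v)) μ (toSite u)) yw.1 yw.2 (Sum.inl α) (Sum.inl β)) =
      -(((((Lc : ℝ) * (sm * sf)) * ((((Lc ^ (0 + 1) : ℕ) : ℝ)) ^ (d + 1 + 1))⁻¹) * ((sf * sm)⁻¹ * (sf⁻¹ * sf⁻¹) * cE))) ^ 2 * (sf * sf) *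
        (((2 : ℝ) * (if μ = ν ∧ α = β then (1 : ℝ) else 0) - (if μ = β ∧ α = ν then (1 : ℝ) else 0) - (if ν = β ∧ α = μ then (1 : ℝ) else 0)) *
          ((1 / 2 : ℝ) * (Lc : ℝ) ^ (d - 1) * ((Lc : ℝ) ^ (d + 1) - (Lc : ℝ) ^ (d - 1)))) := by
  have e1 : (if ν = μ ∧ α = β then (1 : ℝ) else 0) = (if μ = ν ∧ α = β then (1 : ℝ) else 0) := by
    by_cases h1 : μ = ν
    · subst h1; rfl
    · simp [h1, Ne.symm h1]
  rw [ee_word_value' (μ := μ) (ν := ν) (α := α) (β := β) hLc hr sf sm cE, ee_word_swap_value (μ := μ) (ν := ν) (α := α) (β := β) hLc hr sf sm cE, e1]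
  ring

end Value

end Summit.QuantumFields.BalabanUV.Beta.GAN24.EEWordSwap

end
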